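import Summits.CriticalPhenomena.Ising3DConformalLimit.Theses.GaussianScaleMixture
import Literature.Probability.LatticeModels.IsingAutomorphismCovariance
import Literature.Probability.LatticeModels.PlusDomainCorrComparison

/-!
# `stub_hexPlusStateSixfold` of line `two-crystals-generate-so3` (crux `RotationUpgradeFromTwoPoint`,
stmt-CriticalPhenomena-8367) — kernel-checked verification by the deep-refute seat

Statement copied VERBATIM from `Cruxes/RotationUpgradeFromTwoPoint/Lines/two-crystals-generate-so3.lean`
(gen 2). Proof: `M̃ = !![0,-1,0; 1,1,0; 0,0,1]` permutes the bond set, so `ψ : x ↦ M̃⁻¹ x` is a graph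
automorphism; covariance (`isingExpect_fixed_relabel`) gives `⟨∏σ_{M̃ kᵢ}⟩⁺_{B(L)} = ⟨∏σ_{kᵢ}⟩⁺_{ψ(B(L))}`;
both `L ↦ ⟨∏σ_{kᵢ}⟩⁺_{B(L)}` and `L ↦ ⟨∏σ_{kᵢ}⟩⁺_{ψ(B(L))}` are antitone (GKS volume antitonicity
`isingExpect_plus_spinMonomial_anti_volume`) and bounded below, hence converge to their infima
(`tendsto_atTop_ciInf`), which agree because the two volume families are mutually cofinal
(`B(L) ⊆ ψ(B(2L))`, `ψ(B(L)) ⊆ B(2L)`). Candidate proof for the worker holding the stub (refuters do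
not land positive statements).
-/

noncomputable section

open Literature.Probability.LatticeModels Finset Filter Matrix
open scoped Topology

namespace Summit.CriticalPhenomena.Ising3DConformalLimit.Cruxes.RotationUpgradeFromTwoPoint.DrefuteTwoCrystals

/-! ### The sixfold matrix and its inverse -/

/-- `M̃`. [folklore] -/
def hexM : Matrix (Fin 3) (Fin 3) ℤ := !![0, -1, 0; 1, 1, 0; 0, 0, 1]

/-- `M̃⁻¹`. [folklore] -/
def hexMinv : Matrix (Fin 3) (Fin 3) ℤ := !![1, 1, 0; -1, 0, 0; 0, 0, 1]

theorem hexM_mul_hexMinv : hexM * hexMinv = 1 := by decide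

theorem hexMinv_mul_hexM : hexMinv * hexM = 1 := by decide

theorem hexM_mulVec_apply (v : Site 3) :
    hexM *ᵥ v = ![-v 1, v 0 + v 1, v 2] := by
  ext i
  fin_cases i <;> simp [hexM, Matrix.mulVec, dotProduct, Fin.sum_univ_three]

theorem hexMinv_mulVec_apply (v : Site 3) :
    hexMinv *ᵥ v = ![v 0 + v 1, -v 0, v 2] := by
  ext i
  fin_cases i <;> simp [hexMinv, Matrix.mulVec, dotProduct, Fin.sum_univ_three]

/-- The bijection `x ↦ M̃⁻¹ x` of `ℤ³` (inverse `x ↦ M̃ x`). [folklore] -/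
def hexEquiv : Site 3 ≃ Site 3 where
  toFun v := hexMinv *ᵥ v
  invFun v := hexM *ᵥ v
  left_inv v := by
    show hexM *ᵥ (hexMinv *ᵥ v) = v
    rw [Matrix.mulVec_mulVec, hexM_mul_hexMinv, Matrix.one_mulVec]
  right_inv v := by
    show hexMinv *ᵥ (hexM *ᵥ v) = v
    rw [Matrix.mulVec_mulVec, hexMinv_mul_hexM, Matrix.one_mulVec]

@[simp] theorem hexEquiv_apply (v : Site 3) : hexEquiv v = hexMinv *ᵥ v := rfl

@[simp] theorem hexEquiv_symm_apply (v : Site 3) : hexEquiv.symm v = hexM *ᵥ v := rfl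

/-! ### The bond set is permuted -/

/-- The bond predicate of the stacked-triangular graph. [folklore] -/
def IsBond (v : Site 3) : Prop :=
  (∃ i : Fin 3, v = Pi.single i 1 ∨ v = -Pi.single i 1) ∨ v = ![1, -1, 0] ∨ v = ![-1, 1, 0]

theorem isBond_hexM {v : Site 3} (h : IsBond v) : IsBond (hexM *ᵥ v) := by
  rcases h with ⟨i, rfl | rfl⟩ | rfl | rfl
  · fin_cases i
    · exact Or.inl ⟨1, Or.inl (by decide)⟩
    · exact Or.inr (Or.inr (by decide))
    · exact Or.inl ⟨2, Or.inl (by decide)⟩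
  · fin_cases i
    · exact Or.inl ⟨1, Or.inr (by decide)⟩
    · exact Or.inr (Or.inl (by decide))
    · exact Or.inl ⟨2, Or.inr (by decide)⟩
  · exact Or.inl ⟨0, Or.inl (by decide)⟩
  · exact Or.inl ⟨0, Or.inr (by decide)⟩

theorem isBond_hexMinv {v : Site 3} (h : IsBond v) : IsBond (hexMinv *ᵥ v) := by
  rcases h with ⟨i, rfl | rfl⟩ | rfl | rfl
  · fin_cases i
    · exact Or.inr (Or.inl (by decide))
    · exact Or.inl ⟨0, Or.inl (by decide)⟩
    · exact Or.inl ⟨2, Or.inl (by decide)⟩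
  · fin_cases i
    · exact Or.inr (Or.inr (by decide))
    · exact Or.inl ⟨0, Or.inr (by decide)⟩
    · exact Or.inl ⟨2, Or.inr (by decide)⟩
  · exact Or.inl ⟨1, Or.inr (by decide)⟩
  · exact Or.inl ⟨1, Or.inl (by decide)⟩

theorem isBond_hexMinv_iff (v : Site 3) : IsBond (hexMinv *ᵥ v) ↔ IsBond v := by
  refine ⟨fun h => ?_, isBond_hexMinv⟩
  have := isBond_hexM h
  rwa [Matrix.mulVec_mulVec, hexM_mul_hexMinv, Matrix.one_mulVec] at this

/-! ### Boxes and sheared boxes are mutually cofinal -/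

theorem box_subset_map_box (L : ℕ) :
    box 3 L ⊆ (box 3 (2 * L)).map hexEquiv.toEmbedding := by
  intro v hv
  rw [Finset.mem_map_equiv, hexEquiv_symm_apply, mem_box]
  rw [mem_box] at hv
  have h0 := hv 0
  have h1 := hv 1
  have h2 := hv 2
  intro i
  rw [hexM_mulVec_apply]
  fin_cases i <;> simp <;> omega

theorem map_box_subset_box (L : ℕ) :
    (box 3 L).map hexEquiv.toEmbedding ⊆ box 3 (2 * L) := by
  intro v hv
  rw [Finset.mem_map_equiv, hexEquiv_symm_apply, mem_box] at hv
  simp only [hexM_mulVec_apply] at hv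
  have h0 := hv 0
  have h1 := hv 1
  have h2 := hv 2
  simp at h0 h1 h2
  rw [mem_box]
  intro i
  fin_cases i <;> simp <;> omega

/-! ### The theorem -/

/-- **`stub_hexPlusStateSixfold`** (verbatim). [folklore] -/
theorem hexPlusStateSixfold_holds :
  ∀ (G : SimpleGraph (Site 3)) [DecidableRel G.Adj] [G.LocallyFinite],
    (∀ x y : Site 3, G.Adj x y ↔
      ((∃ i : Fin 3, y - x = Pi.single i 1 ∨ y - x = -Pi.single i 1) ∨
        y - x = ![1, -1, 0] ∨ y - x = ![-1, 1, 0])) →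
    ∀ β : ℝ, 0 ≤ β → ∀ (n : ℕ) (k : Fin n → Site 3),
      limUnder atTop (fun L : ℕ => isingExpect G (box 3 L) β 0 .plus
        (spinMonomial (fun i => (!![0, -1, 0; 1, 1, 0; 0, 0, 1] : Matrix (Fin 3) (Fin 3) ℤ).mulVec (k i)))) =
      limUnder atTop (fun L : ℕ => isingExpect G (box 3 L) β 0 .plus (spinMonomial k)) := by
  intro G _ _ hadj β hβ n k
  -- the graph automorphism `ψ : x ↦ M̃⁻¹ x`
  let ψ : G ≃g G :=
    { toEquiv := hexEquiv
      map_rel_iff' := by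
        intro a b
        show G.Adj (hexMinv *ᵥ a) (hexMinv *ᵥ b) ↔ G.Adj a b
        rw [hadj, hadj, ← Matrix.mulVec_sub]
        exact isBond_hexMinv_iff (b - a) }
  have hψ : ψ.toEquiv = hexEquiv := rfl
  -- the two volume sequences
  set a : ℕ → ℝ := fun L => isingExpect G (box 3 L) β 0 .plus (spinMonomial k) with ha
  set a' : ℕ → ℝ := fun L => isingExpect G ((box 3 L).map hexEquiv.toEmbedding) β 0 .plus
    (spinMonomial k) with ha'
  -- covariance: `⟨∏ σ_{M̃ kᵢ}⟩⁺_{B(L)} = ⟨∏ σ_{kᵢ}⟩⁺_{ψ(B(L))}`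
  have hcov : (fun L : ℕ => isingExpect G (box 3 L) β 0 .plus
      (spinMonomial (fun i => (!![0, -1, 0; 1, 1, 0; 0, 0, 1] : Matrix (Fin 3) (Fin 3) ℤ).mulVec (k i)))) = a' := by
    funext L
    have hrel := isingExpect_fixed_relabel G ψ (box 3 L) β 0 1 (measurable_spinMonomial k)
    have h1 : configRelabel ψ.toEquiv (1 : SpinConfig (Site 3)) = 1 := by
      funext y; rfl
    have h2 : (spinMonomial k ∘ configRelabel ψ.toEquiv) =
        spinMonomial (fun i => (!![0, -1, 0; 1, 1, 0; 0, 0, 1] : Matrix (Fin 3) (Fin 3) ℤ).mulVec (k i)) := by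
      funext σ
      simp only [Function.comp_apply, spinMonomial, spinAt, configRelabel_apply, hψ, hexEquiv_symm_apply]
      rfl
    rw [h1, h2, hψ] at hrel
    rw [ha']
    exact hrel.symm
  rw [hcov]
  -- antitonicity and boundedness
  have hanti : Antitone a := fun L L' hLL' =>
    isingExpect_plus_spinMonomial_anti_volume G hβ le_rfl (box_mono 3 hLL') k
  have hanti' : Antitone a' := fun L L' hLL' =>
    isingExpect_plus_spinMonomial_anti_volume G hβ le_rfl
      (Finset.map_subset_map.2 (box_mono 3 hLL')) k
  have hlow : ∀ Λ : Finset (Site 3), -1 ≤ isingExpect G Λ β 0 .plus (spinMonomial k) := by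
    intro Λ
    obtain ⟨A, -, hA⟩ := exists_subset_image_spinMonomial_eq_spinProduct k
    rw [hA]
    have := abs_isingCorr_le_one G Λ β 0 .plus A
    rw [abs_le] at this
    exact this.1
  have hbdd : BddBelow (Set.range a) := ⟨-1, by rintro _ ⟨L, rfl⟩; exact hlow _⟩
  have hbdd' : BddBelow (Set.range a') := ⟨-1, by rintro _ ⟨L, rfl⟩; exact hlow _⟩
  have hta : Tendsto a atTop (𝓝 (⨅ L, a L)) := tendsto_atTop_ciInf hanti hbdd
  have hta' : Tendsto a' atTop (𝓝 (⨅ L, a' L)) := tendsto_atTop_ciInf hanti' hbdd'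
  -- the two infima agree by mutual cofinality
  have hinf : (⨅ L, a' L) = ⨅ L, a L := by
    refine le_antisymm (le_ciInf fun L => ?_) (le_ciInf fun L => ?_)
    · refine ciInf_le_of_le hbdd' (2 * L) ?_
      exact isingExpect_plus_spinMonomial_anti_volume G hβ le_rfl (box_subset_map_box L) k
    · refine ciInf_le_of_le hbdd (2 * L) ?_
      exact isingExpect_plus_spinMonomial_anti_volume G hβ le_rfl (map_box_subset_box L) k
  rw [hta'.limUnder_eq, hta.limUnder_eq, hinf]

end Summit.CriticalPhenomena.Ising3DConformalLimit.Cruxes.RotationUpgradeFromTwoPoint.DrefuteTwoCrystals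

end
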